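import Summits.BirchSwinnertonDyer.BirchSwinnertonDyer.Theorems.PrintX10bControlGlueOfClausesKS
import Summits.BirchSwinnertonDyer.BirchSwinnertonDyer.Theorems.PrintX10bReadoutIndexOfLocalClauses
import Literature.NumberTheory.EllipticCurves.IwasawaSelmerReadoutIndexOfLocalProofs
import Literature.NumberTheory.GaloisCohomology.ArchimedeanInvariantMap
import HarnessLib

/-!
# KS-TWINS of the place-wise (B5) letters: the leaf (CG) replaced by the frame-restricted letter `Stmt.kummerStrictOnFrames`
# (CG-FRAME (E), cell `pub/bsd-print-x9`; pen g14 «GO w3: CG-FRAME» 2026-08-29T00:29Z; seat bsd-line-x10b-p1 LEAD g10)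

Summits-side helper, ROUTE-INDEPENDENT (no `Theses` import): three statement ABBREVIATIONS (letters, nothing asserted) and ONE
theorem; no named fact, no instance, no `sorry`. This file is `PrintX10bReadoutIndexOfLocalClauses` (x10b-p1-w2 g11, p675427)
VERBATIM except that the leading binder of the three letters — the cite-only leaf
`hCG : Greenberg1999.imKummer_eq_strictCondition_goodOrdinary_numberField` — is replaced by the frame-restricted letter
`HeegnerMuPartControlGlue.Stmt.kummerStrictOnFrames` (file `PrintX10bControlGlueOfClausesKS`), and the assembled statement is
the KS-twin `Stmt.readoutIndexKS`. The two auxiliary lemmas of the original (`galoisCohomology_one_toLocal_inl_eq_zero_of_isComplex`,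
`finite_setOf_mem_or_mem`) are imported, not restated. Decls: `Stmt.readoutLocalOffKS`, `Stmt.readoutLocalIndexPKS`,
`Stmt.readoutLocalIndexBadKS`, `readoutIndexKS_of_localClauses` (proof verbatim `readoutIndex_of_localClauses`).
HONEST FRAMING: nothing is discharged here; «beyond-print theorem»: no. BSD is not proved by any of this; no summit statement
is proved by this seat.

References: [Howard2004HeegnerKolyvagin] Lemma 2.2.7 / Prop. 2.2.8 and proof of Thm. 2.2.10 (𝔮 = T^m + p); [GreenbergLNM1716]
Prop. 2.4, §4 p. 98; [MazurRubin2004] Lemma 3.5.3.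
-/

set_option linter.dupNamespace false
set_option autoImplicit false

noncomputable section

open scoped Classical Pointwise ContRepresentation TensorProduct NumberField

open Function NumberField IsDedekindDomain Field
open Literature Literature.NumberTheory.EllipticCurves WeierstrassCurve
open Literature.NumberTheory.GaloisCohomology Literature.NumberTheory.GaloisCohomology.Howard2004
open Literature.NumberTheory.GaloisRepresentations Literature.NumberTheory.GaloisRepresentations.DiscreteGaloisModule
open Summit.BirchSwinnertonDyer.BirchSwinnertonDyer.Theorems

namespace Summit.BirchSwinnertonDyer.BirchSwinnertonDyer.Theorems.HeegnerMuPartControlGlue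

/-! ## §0 At a complex place `H¹(K_w, ·) = 0` -/

/-! ## §1 The letters -/

set_option synthInstance.maxHeartbeats 80000 in
/-- **KS-twin of letter (B5-OFF) `readoutLocalOff`** — at the finite places OUTSIDE `S`, for `m ≫ 0`, every admissible Eisenstein
datum and every tower level `j ≥ j₀`: a class `c ∈ H¹(K, T_j)` whose readout lies in `Sel_{p^∞}(E/K_∞)` has
`loc_v c ∈ condA F j v` (Howard's propagated condition; «no cokernel contribution at the good places»; Howard 2004
Prop. 2.2.8 and proof of Thm. 2.2.10, Greenberg LNM 1716 §3 Lemma 3.3 and §4 p. 104). A LETTER (nothing asserted). -/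
abbrev Stmt.readoutLocalOffKS : Prop :=
  Stmt.kummerStrictOnFrames →
  ∀ (N : ℕ) [NeZero N] (W : WeierstrassCurve ℚ) [W.IsGloballyMinimal] (K : Type) [Field K] [NumberField K]
    (p : ℕ) [Fact p.Prime] (κ : ZpExtension K p) (γ : Field.absoluteGaloisGroup K)
    (jbar : AlgebraicClosure K →+* ℂ) (hyp : CastellaGrossiLeeSkinner2022.Thm413Hypotheses N W K p κ γ),
    ¬ W.HasCM → W.HasIrreducibleModPGaloisRep p → (W.baseChange K).HasIrreducibleModPGaloisRep p →
    MastellaZerman2026.HasPadicScalarImage W p → SatisfiesHeegnerHypothesis p K →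
    p ∣ NumberField.classNumber K →
    ∃ m₁ : ℕ, ∀ (m : ℕ) (hm : 1 ≤ m), m₁ ≤ m →
      haveI := hyp.isElliptic
      letI := IwasawaAlgebra.isDomain_quotient_X_pow_add_C p hm
      letI := IwasawaAlgebra.isDiscreteValuationRing_quotient_X_pow_add_C p hm
      haveI := IwasawaAlgebra.EisensteinCoeff.isLocalRing_succ p hm
      letI := IwasawaAlgebra.EisensteinCoeff.algebraOfSpecSucc p m
      haveI := W.isScalarTower_algebraOfSpecSucc (K := K) (p := p) (m := m)
      letI := W.residueModuleSucc (K := K) (p := p) hm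
      ∀ (S : Finset (IsDedekindDomain.HeightOneSpectrum (NumberField.RingOfIntegers K)))
        (hpS : ∀ v, ((p : ℕ) : NumberField.RingOfIntegers K) ∈ v.asIdeal → v ∈ S)
        (hbad : ∀ v, v ∉ S → ((p : ℕ) : NumberField.RingOfIntegers K) ∉ v.asIdeal →
          (W.baseChange K).HasGoodReductionAt v)
        (_hSN : ∀ v ∈ S, ((p : ℕ) : NumberField.RingOfIntegers K) ∈ v.asIdeal ∨
          ((N : ℕ) : NumberField.RingOfIntegers K) ∈ v.asIdeal)
        (_hSσ : ∀ (σ : K ≃ₐ[ℚ] K) (v : IsDedekindDomain.HeightOneSpectrum (NumberField.RingOfIntegers K)),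
          σ • v ∈ S → v ∈ S)
        (L : Set (IsDedekindDomain.HeightOneSpectrum (NumberField.RingOfIntegers K)))
        (hL : L ⊆ (W.eisensteinTower (κ.unitTwist (-1)) hm).degreeTwoPrimes p)
        (hLS : ∀ v ∈ L, v ∉ S) (jbar' : AlgebraicClosure K →+* ℂ) (cd : ConjugationDatum K)
        (Dd : ∀ k, DualityDatum p cd ((W.eisensteinTower (κ.unitTwist (-1)) hm).ρ k)
          (IwasawaAlgebra.EisensteinCoeff p m (k + 1)))
        (fs : ∀ (k : ℕ) (n : Finset (IsDedekindDomain.HeightOneSpectrum (NumberField.RingOfIntegers K)))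
          (v : IsDedekindDomain.HeightOneSpectrum (NumberField.RingOfIntegers K)),
          galoisCohomology ((W.eisensteinLevelQuot (κ.unitTwist (-1)) hm k n).toLocal (Sum.inr v)) 1 →+
            SingularQuotient (GaloisRep.toLocal v (W.eisensteinLevelQuot (κ.unitTwist (-1)) hm k n)) ⊗[ℤ]
              Gell v)
        (hy : (W.eisensteinDVRSetting (κ.unitTwist (-1)) hm S hpS hbad L hL hLS jbar' cd Dd fs).SatisfiesH)
        (hπ : (W.eisensteinDVRSetting (κ.unitTwist (-1)) hm S hpS hbad L hL hLS jbar' cd Dd fs).π ∈ IsLocalRing.maximalIdeal (IwasawaAlgebra p ⧸ Ideal.span {(PowerSeries.X ^ m + PowerSeries.C (p : ℤ_[p]) : IwasawaAlgebra p)}))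
        (he : ∀ k, (W.eisensteinDVRSetting (κ.unitTwist (-1)) hm S hpS hbad L hL hLS jbar' cd Dd fs).e k ≤ (W.eisensteinDVRSetting (κ.unitTwist (-1)) hm S hpS hbad L hL hLS jbar' cd Dd fs).e (k + 1))
        (hπX : (W.eisensteinDVRSetting (κ.unitTwist (-1)) hm S hpS hbad L hL hLS jbar' cd Dd fs).π =
          Ideal.Quotient.mk (Ideal.span {(PowerSeries.X ^ m + PowerSeries.C (p : ℤ_[p]) : IwasawaAlgebra p)}) PowerSeries.X)
        (hek : ∀ k, (W.eisensteinDVRSetting (κ.unitTwist (-1)) hm S hpS hbad L hL hLS jbar' cd Dd fs).e (k + 1) - (W.eisensteinDVRSetting (κ.unitTwist (-1)) hm S hpS hbad L hL hLS jbar' cd Dd fs).e k = m),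
        ∃ j₀ : ℕ, ∀ (j : ℕ), j₀ ≤ j → ∀ c : galoisCohomology ((W.eisensteinDVRSetting (κ.unitTwist (-1)) hm S hpS hbad L hL hLS jbar' cd Dd fs).T.ρ j) 1,
          W.eisensteinTowerReadout κ hm (W.eisensteinDVRSetting (κ.unitTwist (-1)) hm S hpS hbad L hL hLS jbar' cd Dd fs).π (W.eisensteinDVRSetting (κ.unitTwist (-1)) hm S hpS hbad L hL hLS jbar' cd Dd fs).e hy.killed hy.ker_red hπ he hπX hek
              (AddCommGroup.DirectLimit.of (fun k => galoisCohomology ((W.eisensteinDVRSetting (κ.unitTwist (-1)) hm S hpS hbad L hL hLS jbar' cd Dd fs).T.ρ k) 1)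
                (AdicTower.incH1LE (W.eisensteinDVRSetting (κ.unitTwist (-1)) hm S hpS hbad L hL hLS jbar' cd Dd fs).T (W.eisensteinDVRSetting (κ.unitTwist (-1)) hm S hpS hbad L hL hLS jbar' cd Dd fs).π (W.eisensteinDVRSetting (κ.unitTwist (-1)) hm S hpS hbad L hL hLS jbar' cd Dd fs).e hy.killed hy.ker_red hπ he) j c) ∈
            (W.baseChange K).selmerInfty κ →
          ∀ v : IsDedekindDomain.HeightOneSpectrum (NumberField.RingOfIntegers K), v ∉ S →
            galoisCohomology.localization ((W.eisensteinDVRSetting (κ.unitTwist (-1)) hm S hpS hbad L hL hLS jbar' cd Dd fs).T.ρ j) (Sum.inr v) 1 c ∈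
              AdicTower.condA (W.eisensteinDVRSetting (κ.unitTwist (-1)) hm S hpS hbad L hL hLS jbar' cd Dd fs).T (W.eisensteinDVRSetting (κ.unitTwist (-1)) hm S hpS hbad L hL hLS jbar' cd Dd fs).π (W.eisensteinDVRSetting (κ.unitTwist (-1)) hm S hpS hbad L hL hLS jbar' cd Dd fs).e hy.killed hy.ker_red hπ he
                (fun k => ((W.eisensteinDVRSetting (κ.unitTwist (-1)) hm S hpS hbad L hL hLS jbar' cd Dd fs).t k).cond) j (Sum.inr v)

set_option synthInstance.maxHeartbeats 80000 in
/-- **KS-twin of letter (B5-P) `readoutLocalIndexP`** — at the places `v ∈ S` ABOVE `p`, for `m ≫ 0`, every admissible Eisenstein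
datum and every tower level `j ≥ j₀`: a relaxed local condition `F'_v ≤ H¹(K_v, T_j)` containing `loc_v c` for every class
`c ∈ H¹(K, T_j)` whose readout lies in `Sel_{p^∞}(E/K_∞)`, with `F'_v ⧸ (condA F j v ∩ F'_v)` finite of order `≤ p^c`, the
constant `c` INDEPENDENT of `m`, `j` and the datum (Coates–Greenberg at `w ∣ p`: Greenberg LNM 1716 Prop. 2.4 is the
leading binder; the `m`-uniform kernel count of `H¹(K_v, gr) → H¹(K_{∞,w}, gr)`; Howard 2004 Prop. 2.2.8 and proof of
Thm. 2.2.10, Greenberg LNM 1716 Prop. 2.4 and §4 pp. 98, 104). A LETTER (nothing asserted). -/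
abbrev Stmt.readoutLocalIndexPKS : Prop :=
  Stmt.kummerStrictOnFrames →
  ∀ (N : ℕ) [NeZero N] (W : WeierstrassCurve ℚ) [W.IsGloballyMinimal] (K : Type) [Field K] [NumberField K]
    (p : ℕ) [Fact p.Prime] (κ : ZpExtension K p) (γ : Field.absoluteGaloisGroup K)
    (jbar : AlgebraicClosure K →+* ℂ) (hyp : CastellaGrossiLeeSkinner2022.Thm413Hypotheses N W K p κ γ),
    ¬ W.HasCM → W.HasIrreducibleModPGaloisRep p → (W.baseChange K).HasIrreducibleModPGaloisRep p →
    MastellaZerman2026.HasPadicScalarImage W p → SatisfiesHeegnerHypothesis p K →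
    p ∣ NumberField.classNumber K →
    ∃ c m₁ : ℕ, ∀ (m : ℕ) (hm : 1 ≤ m), m₁ ≤ m →
      haveI := hyp.isElliptic
      letI := IwasawaAlgebra.isDomain_quotient_X_pow_add_C p hm
      letI := IwasawaAlgebra.isDiscreteValuationRing_quotient_X_pow_add_C p hm
      haveI := IwasawaAlgebra.EisensteinCoeff.isLocalRing_succ p hm
      letI := IwasawaAlgebra.EisensteinCoeff.algebraOfSpecSucc p m
      haveI := W.isScalarTower_algebraOfSpecSucc (K := K) (p := p) (m := m)
      letI := W.residueModuleSucc (K := K) (p := p) hm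
      ∀ (S : Finset (IsDedekindDomain.HeightOneSpectrum (NumberField.RingOfIntegers K)))
        (hpS : ∀ v, ((p : ℕ) : NumberField.RingOfIntegers K) ∈ v.asIdeal → v ∈ S)
        (hbad : ∀ v, v ∉ S → ((p : ℕ) : NumberField.RingOfIntegers K) ∉ v.asIdeal →
          (W.baseChange K).HasGoodReductionAt v)
        (_hSN : ∀ v ∈ S, ((p : ℕ) : NumberField.RingOfIntegers K) ∈ v.asIdeal ∨
          ((N : ℕ) : NumberField.RingOfIntegers K) ∈ v.asIdeal)
        (_hSσ : ∀ (σ : K ≃ₐ[ℚ] K) (v : IsDedekindDomain.HeightOneSpectrum (NumberField.RingOfIntegers K)),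
          σ • v ∈ S → v ∈ S)
        (L : Set (IsDedekindDomain.HeightOneSpectrum (NumberField.RingOfIntegers K)))
        (hL : L ⊆ (W.eisensteinTower (κ.unitTwist (-1)) hm).degreeTwoPrimes p)
        (hLS : ∀ v ∈ L, v ∉ S) (jbar' : AlgebraicClosure K →+* ℂ) (cd : ConjugationDatum K)
        (Dd : ∀ k, DualityDatum p cd ((W.eisensteinTower (κ.unitTwist (-1)) hm).ρ k)
          (IwasawaAlgebra.EisensteinCoeff p m (k + 1)))
        (fs : ∀ (k : ℕ) (n : Finset (IsDedekindDomain.HeightOneSpectrum (NumberField.RingOfIntegers K)))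
          (v : IsDedekindDomain.HeightOneSpectrum (NumberField.RingOfIntegers K)),
          galoisCohomology ((W.eisensteinLevelQuot (κ.unitTwist (-1)) hm k n).toLocal (Sum.inr v)) 1 →+
            SingularQuotient (GaloisRep.toLocal v (W.eisensteinLevelQuot (κ.unitTwist (-1)) hm k n)) ⊗[ℤ]
              Gell v)
        (hy : (W.eisensteinDVRSetting (κ.unitTwist (-1)) hm S hpS hbad L hL hLS jbar' cd Dd fs).SatisfiesH)
        (hπ : (W.eisensteinDVRSetting (κ.unitTwist (-1)) hm S hpS hbad L hL hLS jbar' cd Dd fs).π ∈ IsLocalRing.maximalIdeal (IwasawaAlgebra p ⧸ Ideal.span {(PowerSeries.X ^ m + PowerSeries.C (p : ℤ_[p]) : IwasawaAlgebra p)}))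
        (he : ∀ k, (W.eisensteinDVRSetting (κ.unitTwist (-1)) hm S hpS hbad L hL hLS jbar' cd Dd fs).e k ≤ (W.eisensteinDVRSetting (κ.unitTwist (-1)) hm S hpS hbad L hL hLS jbar' cd Dd fs).e (k + 1))
        (hπX : (W.eisensteinDVRSetting (κ.unitTwist (-1)) hm S hpS hbad L hL hLS jbar' cd Dd fs).π =
          Ideal.Quotient.mk (Ideal.span {(PowerSeries.X ^ m + PowerSeries.C (p : ℤ_[p]) : IwasawaAlgebra p)}) PowerSeries.X)
        (hek : ∀ k, (W.eisensteinDVRSetting (κ.unitTwist (-1)) hm S hpS hbad L hL hLS jbar' cd Dd fs).e (k + 1) - (W.eisensteinDVRSetting (κ.unitTwist (-1)) hm S hpS hbad L hL hLS jbar' cd Dd fs).e k = m),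
        ∃ j₀ : ℕ, ∀ (j : ℕ), j₀ ≤ j →
          ∀ v ∈ S, ((p : ℕ) : NumberField.RingOfIntegers K) ∈ v.asIdeal →
            ∃ Fv : AddSubgroup (galoisCohomology (((W.eisensteinDVRSetting (κ.unitTwist (-1)) hm S hpS hbad L hL hLS jbar' cd Dd fs).T.ρ j).toLocal (Sum.inr v)) 1),
              (∀ c : galoisCohomology ((W.eisensteinDVRSetting (κ.unitTwist (-1)) hm S hpS hbad L hL hLS jbar' cd Dd fs).T.ρ j) 1,
                W.eisensteinTowerReadout κ hm (W.eisensteinDVRSetting (κ.unitTwist (-1)) hm S hpS hbad L hL hLS jbar' cd Dd fs).π (W.eisensteinDVRSetting (κ.unitTwist (-1)) hm S hpS hbad L hL hLS jbar' cd Dd fs).e hy.killed hy.ker_red hπ he hπX hek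
              (AddCommGroup.DirectLimit.of (fun k => galoisCohomology ((W.eisensteinDVRSetting (κ.unitTwist (-1)) hm S hpS hbad L hL hLS jbar' cd Dd fs).T.ρ k) 1)
                (AdicTower.incH1LE (W.eisensteinDVRSetting (κ.unitTwist (-1)) hm S hpS hbad L hL hLS jbar' cd Dd fs).T (W.eisensteinDVRSetting (κ.unitTwist (-1)) hm S hpS hbad L hL hLS jbar' cd Dd fs).π (W.eisensteinDVRSetting (κ.unitTwist (-1)) hm S hpS hbad L hL hLS jbar' cd Dd fs).e hy.killed hy.ker_red hπ he) j c) ∈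
            (W.baseChange K).selmerInfty κ →
                galoisCohomology.localization ((W.eisensteinDVRSetting (κ.unitTwist (-1)) hm S hpS hbad L hL hLS jbar' cd Dd fs).T.ρ j) (Sum.inr v) 1 c ∈ Fv) ∧
              Finite (↥Fv ⧸ (AdicTower.condA (W.eisensteinDVRSetting (κ.unitTwist (-1)) hm S hpS hbad L hL hLS jbar' cd Dd fs).T (W.eisensteinDVRSetting (κ.unitTwist (-1)) hm S hpS hbad L hL hLS jbar' cd Dd fs).π (W.eisensteinDVRSetting (κ.unitTwist (-1)) hm S hpS hbad L hL hLS jbar' cd Dd fs).e hy.killed hy.ker_red hπ he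
                (fun k => ((W.eisensteinDVRSetting (κ.unitTwist (-1)) hm S hpS hbad L hL hLS jbar' cd Dd fs).t k).cond) j (Sum.inr v)).addSubgroupOf Fv) ∧
              Nat.card (↥Fv ⧸ (AdicTower.condA (W.eisensteinDVRSetting (κ.unitTwist (-1)) hm S hpS hbad L hL hLS jbar' cd Dd fs).T (W.eisensteinDVRSetting (κ.unitTwist (-1)) hm S hpS hbad L hL hLS jbar' cd Dd fs).π (W.eisensteinDVRSetting (κ.unitTwist (-1)) hm S hpS hbad L hL hLS jbar' cd Dd fs).e hy.killed hy.ker_red hπ he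
                (fun k => ((W.eisensteinDVRSetting (κ.unitTwist (-1)) hm S hpS hbad L hL hLS jbar' cd Dd fs).t k).cond) j (Sum.inr v)).addSubgroupOf Fv) ≤ p ^ c

set_option synthInstance.maxHeartbeats 80000 in
/-- **KS-twin of letter (B5-BAD) `readoutLocalIndexBad`** — at the places `v ∈ S` NOT above `p` (so above `N`, by `_hSN`: bad
reduction), for `m ≫ 0`, every admissible Eisenstein datum and every tower level `j ≥ j₀`: a relaxed local condition
`F'_v ≤ H¹(K_v, T_j)` containing `loc_v c` for every class `c ∈ H¹(K, T_j)` whose readout lies in `Sel_{p^∞}(E/K_∞)`, with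
`F'_v ⧸ (condA F j v ∩ F'_v)` finite of order `≤ p^c`, `c` INDEPENDENT of `m`, `j` and the datum (the classes dying over
`K_{∞,w}`, counted by `H¹(Γ_v, E(K_{∞,w})[p^∞] ⊗ S_m(ψ⁻¹))`; Howard 2004 Prop. 2.2.8 and proof of Thm. 2.2.10,
Greenberg LNM 1716 §3 Lemma 3.3 and §4 pp. 98, 104). A LETTER (nothing asserted). -/
abbrev Stmt.readoutLocalIndexBadKS : Prop :=
  Stmt.kummerStrictOnFrames →
  ∀ (N : ℕ) [NeZero N] (W : WeierstrassCurve ℚ) [W.IsGloballyMinimal] (K : Type) [Field K] [NumberField K]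
    (p : ℕ) [Fact p.Prime] (κ : ZpExtension K p) (γ : Field.absoluteGaloisGroup K)
    (jbar : AlgebraicClosure K →+* ℂ) (hyp : CastellaGrossiLeeSkinner2022.Thm413Hypotheses N W K p κ γ),
    ¬ W.HasCM → W.HasIrreducibleModPGaloisRep p → (W.baseChange K).HasIrreducibleModPGaloisRep p →
    MastellaZerman2026.HasPadicScalarImage W p → SatisfiesHeegnerHypothesis p K →
    p ∣ NumberField.classNumber K →
    ∃ c m₁ : ℕ, ∀ (m : ℕ) (hm : 1 ≤ m), m₁ ≤ m →
      haveI := hyp.isElliptic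
      letI := IwasawaAlgebra.isDomain_quotient_X_pow_add_C p hm
      letI := IwasawaAlgebra.isDiscreteValuationRing_quotient_X_pow_add_C p hm
      haveI := IwasawaAlgebra.EisensteinCoeff.isLocalRing_succ p hm
      letI := IwasawaAlgebra.EisensteinCoeff.algebraOfSpecSucc p m
      haveI := W.isScalarTower_algebraOfSpecSucc (K := K) (p := p) (m := m)
      letI := W.residueModuleSucc (K := K) (p := p) hm
      ∀ (S : Finset (IsDedekindDomain.HeightOneSpectrum (NumberField.RingOfIntegers K)))
        (hpS : ∀ v, ((p : ℕ) : NumberField.RingOfIntegers K) ∈ v.asIdeal → v ∈ S)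
        (hbad : ∀ v, v ∉ S → ((p : ℕ) : NumberField.RingOfIntegers K) ∉ v.asIdeal →
          (W.baseChange K).HasGoodReductionAt v)
        (_hSN : ∀ v ∈ S, ((p : ℕ) : NumberField.RingOfIntegers K) ∈ v.asIdeal ∨
          ((N : ℕ) : NumberField.RingOfIntegers K) ∈ v.asIdeal)
        (_hSσ : ∀ (σ : K ≃ₐ[ℚ] K) (v : IsDedekindDomain.HeightOneSpectrum (NumberField.RingOfIntegers K)),
          σ • v ∈ S → v ∈ S)
        (L : Set (IsDedekindDomain.HeightOneSpectrum (NumberField.RingOfIntegers K)))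
        (hL : L ⊆ (W.eisensteinTower (κ.unitTwist (-1)) hm).degreeTwoPrimes p)
        (hLS : ∀ v ∈ L, v ∉ S) (jbar' : AlgebraicClosure K →+* ℂ) (cd : ConjugationDatum K)
        (Dd : ∀ k, DualityDatum p cd ((W.eisensteinTower (κ.unitTwist (-1)) hm).ρ k)
          (IwasawaAlgebra.EisensteinCoeff p m (k + 1)))
        (fs : ∀ (k : ℕ) (n : Finset (IsDedekindDomain.HeightOneSpectrum (NumberField.RingOfIntegers K)))
          (v : IsDedekindDomain.HeightOneSpectrum (NumberField.RingOfIntegers K)),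
          galoisCohomology ((W.eisensteinLevelQuot (κ.unitTwist (-1)) hm k n).toLocal (Sum.inr v)) 1 →+
            SingularQuotient (GaloisRep.toLocal v (W.eisensteinLevelQuot (κ.unitTwist (-1)) hm k n)) ⊗[ℤ]
              Gell v)
        (hy : (W.eisensteinDVRSetting (κ.unitTwist (-1)) hm S hpS hbad L hL hLS jbar' cd Dd fs).SatisfiesH)
        (hπ : (W.eisensteinDVRSetting (κ.unitTwist (-1)) hm S hpS hbad L hL hLS jbar' cd Dd fs).π ∈ IsLocalRing.maximalIdeal (IwasawaAlgebra p ⧸ Ideal.span {(PowerSeries.X ^ m + PowerSeries.C (p : ℤ_[p]) : IwasawaAlgebra p)}))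
        (he : ∀ k, (W.eisensteinDVRSetting (κ.unitTwist (-1)) hm S hpS hbad L hL hLS jbar' cd Dd fs).e k ≤ (W.eisensteinDVRSetting (κ.unitTwist (-1)) hm S hpS hbad L hL hLS jbar' cd Dd fs).e (k + 1))
        (hπX : (W.eisensteinDVRSetting (κ.unitTwist (-1)) hm S hpS hbad L hL hLS jbar' cd Dd fs).π =
          Ideal.Quotient.mk (Ideal.span {(PowerSeries.X ^ m + PowerSeries.C (p : ℤ_[p]) : IwasawaAlgebra p)}) PowerSeries.X)
        (hek : ∀ k, (W.eisensteinDVRSetting (κ.unitTwist (-1)) hm S hpS hbad L hL hLS jbar' cd Dd fs).e (k + 1) - (W.eisensteinDVRSetting (κ.unitTwist (-1)) hm S hpS hbad L hL hLS jbar' cd Dd fs).e k = m),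
        ∃ j₀ : ℕ, ∀ (j : ℕ), j₀ ≤ j →
          ∀ v ∈ S, ((p : ℕ) : NumberField.RingOfIntegers K) ∉ v.asIdeal →
            ∃ Fv : AddSubgroup (galoisCohomology (((W.eisensteinDVRSetting (κ.unitTwist (-1)) hm S hpS hbad L hL hLS jbar' cd Dd fs).T.ρ j).toLocal (Sum.inr v)) 1),
              (∀ c : galoisCohomology ((W.eisensteinDVRSetting (κ.unitTwist (-1)) hm S hpS hbad L hL hLS jbar' cd Dd fs).T.ρ j) 1,
                W.eisensteinTowerReadout κ hm (W.eisensteinDVRSetting (κ.unitTwist (-1)) hm S hpS hbad L hL hLS jbar' cd Dd fs).π (W.eisensteinDVRSetting (κ.unitTwist (-1)) hm S hpS hbad L hL hLS jbar' cd Dd fs).e hy.killed hy.ker_red hπ he hπX hek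
              (AddCommGroup.DirectLimit.of (fun k => galoisCohomology ((W.eisensteinDVRSetting (κ.unitTwist (-1)) hm S hpS hbad L hL hLS jbar' cd Dd fs).T.ρ k) 1)
                (AdicTower.incH1LE (W.eisensteinDVRSetting (κ.unitTwist (-1)) hm S hpS hbad L hL hLS jbar' cd Dd fs).T (W.eisensteinDVRSetting (κ.unitTwist (-1)) hm S hpS hbad L hL hLS jbar' cd Dd fs).π (W.eisensteinDVRSetting (κ.unitTwist (-1)) hm S hpS hbad L hL hLS jbar' cd Dd fs).e hy.killed hy.ker_red hπ he) j c) ∈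
            (W.baseChange K).selmerInfty κ →
                galoisCohomology.localization ((W.eisensteinDVRSetting (κ.unitTwist (-1)) hm S hpS hbad L hL hLS jbar' cd Dd fs).T.ρ j) (Sum.inr v) 1 c ∈ Fv) ∧
              Finite (↥Fv ⧸ (AdicTower.condA (W.eisensteinDVRSetting (κ.unitTwist (-1)) hm S hpS hbad L hL hLS jbar' cd Dd fs).T (W.eisensteinDVRSetting (κ.unitTwist (-1)) hm S hpS hbad L hL hLS jbar' cd Dd fs).π (W.eisensteinDVRSetting (κ.unitTwist (-1)) hm S hpS hbad L hL hLS jbar' cd Dd fs).e hy.killed hy.ker_red hπ he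
                (fun k => ((W.eisensteinDVRSetting (κ.unitTwist (-1)) hm S hpS hbad L hL hLS jbar' cd Dd fs).t k).cond) j (Sum.inr v)).addSubgroupOf Fv) ∧
              Nat.card (↥Fv ⧸ (AdicTower.condA (W.eisensteinDVRSetting (κ.unitTwist (-1)) hm S hpS hbad L hL hLS jbar' cd Dd fs).T (W.eisensteinDVRSetting (κ.unitTwist (-1)) hm S hpS hbad L hL hLS jbar' cd Dd fs).π (W.eisensteinDVRSetting (κ.unitTwist (-1)) hm S hpS hbad L hL hLS jbar' cd Dd fs).e hy.killed hy.ker_red hπ he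
                (fun k => ((W.eisensteinDVRSetting (κ.unitTwist (-1)) hm S hpS hbad L hL hLS jbar' cd Dd fs).t k).cond) j (Sum.inr v)).addSubgroupOf Fv) ≤ p ^ c

/-! ## §2 The assembly -/

set_option maxHeartbeats 4000000 in
set_option synthInstance.maxHeartbeats 80000 in
/-- **`stub_readoutIndex` (B5) from the three place-wise clauses** (see the module docstring for the chain).
[cite: Howard2004HeegnerKolyvagin, Prop. 2.2.8 (second map) and proof of Thm. 2.2.10 (𝔮 = T^m + p)]
[cite: GreenbergLNM1716, Prop. 2.4, §3 Lemma 3.3 and §4 pp. 98, 104] [cite: MastellaZerman2026, Thm. 2.40] -/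
theorem readoutIndexKS_of_localClauses (hOff : Stmt.readoutLocalOffKS) (hP : Stmt.readoutLocalIndexPKS)
    (hBad : Stmt.readoutLocalIndexBadKS) : Stmt.readoutIndexKS := by
  intro hKS N _ W _ K _ _ p _ κ γ jbar hyp hCM hirr hirrK hsc hHp hhK
  haveI := hyp.isElliptic
  haveI : IsTotallyComplex K := hyp.isImaginaryQuadratic.isTotallyComplex
  obtain ⟨m₁, hOff₁⟩ := hOff hKS N W K p κ γ jbar hyp hCM hirr hirrK hsc hHp hhK
  obtain ⟨cP, m₂, hP₁⟩ := hP hKS N W K p κ γ jbar hyp hCM hirr hirrK hsc hHp hhK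
  obtain ⟨cB, m₃, hB₁⟩ := hBad hKS N W K p κ γ jbar hyp hCM hirr hirrK hsc hHp hhK
  -- the admissible `S` are confined to the finitely many places above `pN`
  have hS₀ := finite_setOf_mem_or_mem (K := K) p N
  refine ⟨(cP + cB) * hS₀.toFinset.card, m₁ + m₂ + m₃, fun m hm hmle ↦ ?_⟩
  letI := IwasawaAlgebra.isDomain_quotient_X_pow_add_C p hm
  letI := IwasawaAlgebra.isDiscreteValuationRing_quotient_X_pow_add_C p hm
  haveI := IwasawaAlgebra.EisensteinCoeff.isLocalRing_succ p hm
  letI := IwasawaAlgebra.EisensteinCoeff.algebraOfSpecSucc p m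
  haveI := W.isScalarTower_algebraOfSpecSucc (K := K) (p := p) (m := m)
  letI := W.residueModuleSucc (K := K) (p := p) hm
  have hm₁ : m₁ ≤ m := by omega
  have hm₂ : m₂ ≤ m := by omega
  have hm₃ : m₃ ≤ m := by omega
  have hppos : 0 < p := (Fact.out : p.Prime).pos
  intro S hpS hbad hSN hSσ L hL hLS jbar' cd Dd fs hy hπ he hπX hek
  have hScard : S.card ≤ hS₀.toFinset.card :=
    Finset.card_le_card fun v hv ↦ hS₀.mem_toFinset.mpr (hSN v hv)
  -- the three clauses at this `m` and datum
  obtain ⟨j₁, hOff₂⟩ := hOff₁ m hm hm₁ S hpS hbad hSN hSσ L hL hLS jbar' cd Dd fs hy hπ he hπX hek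
  obtain ⟨j₂, hP₂⟩ := hP₁ m hm hm₂ S hpS hbad hSN hSσ L hL hLS jbar' cd Dd fs hy hπ he hπX hek
  obtain ⟨j₃, hB₂⟩ := hB₁ m hm hm₃ S hpS hbad hSN hSσ L hL hLS jbar' cd Dd fs hy hπ he hπX hek
  have hj₁ : ∀ j, j₁ + j₂ + j₃ ≤ j → j₁ ≤ j := fun j h ↦ by omega
  have hj₂ : ∀ j, j₁ + j₂ + j₃ ≤ j → j₂ ≤ j := fun j h ↦ by omega
  have hj₃ : ∀ j, j₁ + j₂ + j₃ ≤ j → j₃ ≤ j := fun j h ↦ by omega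
  -- the relaxed local conditions, CHOSEN from the two index clauses at `v ∈ S` (`⊤` where nothing is asked)
  have hex : ∀ (j : ℕ) (v : IsDedekindDomain.HeightOneSpectrum (NumberField.RingOfIntegers K)),
      ∃ Fv : AddSubgroup (galoisCohomology (((W.eisensteinDVRSetting (κ.unitTwist (-1)) hm S hpS hbad L hL hLS jbar' cd Dd fs).T.ρ j).toLocal (Sum.inr v)) 1),
        j₁ + j₂ + j₃ ≤ j → v ∈ S →
          (∀ c : galoisCohomology ((W.eisensteinDVRSetting (κ.unitTwist (-1)) hm S hpS hbad L hL hLS jbar' cd Dd fs).T.ρ j) 1,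
            W.eisensteinTowerReadout κ hm (W.eisensteinDVRSetting (κ.unitTwist (-1)) hm S hpS hbad L hL hLS jbar' cd Dd fs).π (W.eisensteinDVRSetting (κ.unitTwist (-1)) hm S hpS hbad L hL hLS jbar' cd Dd fs).e hy.killed hy.ker_red hπ he hπX hek
              (AddCommGroup.DirectLimit.of (fun k => galoisCohomology ((W.eisensteinDVRSetting (κ.unitTwist (-1)) hm S hpS hbad L hL hLS jbar' cd Dd fs).T.ρ k) 1)
                (AdicTower.incH1LE (W.eisensteinDVRSetting (κ.unitTwist (-1)) hm S hpS hbad L hL hLS jbar' cd Dd fs).T (W.eisensteinDVRSetting (κ.unitTwist (-1)) hm S hpS hbad L hL hLS jbar' cd Dd fs).π (W.eisensteinDVRSetting (κ.unitTwist (-1)) hm S hpS hbad L hL hLS jbar' cd Dd fs).e hy.killed hy.ker_red hπ he) j c) ∈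
            (W.baseChange K).selmerInfty κ →
            galoisCohomology.localization ((W.eisensteinDVRSetting (κ.unitTwist (-1)) hm S hpS hbad L hL hLS jbar' cd Dd fs).T.ρ j) (Sum.inr v) 1 c ∈ Fv) ∧
          Finite (↥Fv ⧸ (AdicTower.condA (W.eisensteinDVRSetting (κ.unitTwist (-1)) hm S hpS hbad L hL hLS jbar' cd Dd fs).T (W.eisensteinDVRSetting (κ.unitTwist (-1)) hm S hpS hbad L hL hLS jbar' cd Dd fs).π (W.eisensteinDVRSetting (κ.unitTwist (-1)) hm S hpS hbad L hL hLS jbar' cd Dd fs).e hy.killed hy.ker_red hπ he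
                (fun k => ((W.eisensteinDVRSetting (κ.unitTwist (-1)) hm S hpS hbad L hL hLS jbar' cd Dd fs).t k).cond) j (Sum.inr v)).addSubgroupOf Fv) ∧
          Nat.card (↥Fv ⧸ (AdicTower.condA (W.eisensteinDVRSetting (κ.unitTwist (-1)) hm S hpS hbad L hL hLS jbar' cd Dd fs).T (W.eisensteinDVRSetting (κ.unitTwist (-1)) hm S hpS hbad L hL hLS jbar' cd Dd fs).π (W.eisensteinDVRSetting (κ.unitTwist (-1)) hm S hpS hbad L hL hLS jbar' cd Dd fs).e hy.killed hy.ker_red hπ he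
                (fun k => ((W.eisensteinDVRSetting (κ.unitTwist (-1)) hm S hpS hbad L hL hLS jbar' cd Dd fs).t k).cond) j (Sum.inr v)).addSubgroupOf Fv) ≤ p ^ (cP + cB) := by
    intro j v
    by_cases hj : j₁ + j₂ + j₃ ≤ j
    · by_cases hv : v ∈ S
      · by_cases hp : ((p : ℕ) : NumberField.RingOfIntegers K) ∈ v.asIdeal
        · obtain ⟨Fv, h1, h2, h3⟩ := hP₂ j (hj₂ j hj) v hv hp
          exact ⟨Fv, fun _ _ ↦ ⟨h1, h2, h3.trans (Nat.pow_le_pow_right hppos (Nat.le_add_right _ _))⟩⟩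
        · obtain ⟨Fv, h1, h2, h3⟩ := hB₂ j (hj₃ j hj) v hv hp
          exact ⟨Fv, fun _ _ ↦ ⟨h1, h2, h3.trans (Nat.pow_le_pow_right hppos (Nat.le_add_left _ _))⟩⟩
      · exact ⟨⊤, fun _ h ↦ (hv h).elim⟩
    · exact ⟨⊤, fun h _ ↦ (hj h).elim⟩
  let F' : ∀ j, SelmerStructure ((W.eisensteinDVRSetting (κ.unitTwist (-1)) hm S hpS hbad L hL hLS jbar' cd Dd fs).T.ρ j) := fun j v ↦
    match v with
    | Sum.inl _ => ⊤
    | Sum.inr v => Classical.choose (hex j v)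
  -- (hS') the relaxed conditions contain the local classes
  have hS' : ∀ j, j₁ + j₂ + j₃ ≤ j → ∀ c : galoisCohomology ((W.eisensteinDVRSetting (κ.unitTwist (-1)) hm S hpS hbad L hL hLS jbar' cd Dd fs).T.ρ j) 1,
      W.eisensteinTowerReadout κ hm (W.eisensteinDVRSetting (κ.unitTwist (-1)) hm S hpS hbad L hL hLS jbar' cd Dd fs).π (W.eisensteinDVRSetting (κ.unitTwist (-1)) hm S hpS hbad L hL hLS jbar' cd Dd fs).e hy.killed hy.ker_red hπ he hπX hek
              (AddCommGroup.DirectLimit.of (fun k => galoisCohomology ((W.eisensteinDVRSetting (κ.unitTwist (-1)) hm S hpS hbad L hL hLS jbar' cd Dd fs).T.ρ k) 1)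
                (AdicTower.incH1LE (W.eisensteinDVRSetting (κ.unitTwist (-1)) hm S hpS hbad L hL hLS jbar' cd Dd fs).T (W.eisensteinDVRSetting (κ.unitTwist (-1)) hm S hpS hbad L hL hLS jbar' cd Dd fs).π (W.eisensteinDVRSetting (κ.unitTwist (-1)) hm S hpS hbad L hL hLS jbar' cd Dd fs).e hy.killed hy.ker_red hπ he) j c) ∈
            (W.baseChange K).selmerInfty κ →
      ∀ v ∈ S, galoisCohomology.localization ((W.eisensteinDVRSetting (κ.unitTwist (-1)) hm S hpS hbad L hL hLS jbar' cd Dd fs).T.ρ j) (Sum.inr v) 1 c ∈ F' j (Sum.inr v) :=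
    fun j hj c hc v hv ↦ ((Classical.choose_spec (hex j v)) hj hv).1 c hc
  -- (hoff) outside `S`: Howard's condition itself
  have hoff' : ∀ j, j₁ + j₂ + j₃ ≤ j → ∀ c : galoisCohomology ((W.eisensteinDVRSetting (κ.unitTwist (-1)) hm S hpS hbad L hL hLS jbar' cd Dd fs).T.ρ j) 1,
      W.eisensteinTowerReadout κ hm (W.eisensteinDVRSetting (κ.unitTwist (-1)) hm S hpS hbad L hL hLS jbar' cd Dd fs).π (W.eisensteinDVRSetting (κ.unitTwist (-1)) hm S hpS hbad L hL hLS jbar' cd Dd fs).e hy.killed hy.ker_red hπ he hπX hek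
              (AddCommGroup.DirectLimit.of (fun k => galoisCohomology ((W.eisensteinDVRSetting (κ.unitTwist (-1)) hm S hpS hbad L hL hLS jbar' cd Dd fs).T.ρ k) 1)
                (AdicTower.incH1LE (W.eisensteinDVRSetting (κ.unitTwist (-1)) hm S hpS hbad L hL hLS jbar' cd Dd fs).T (W.eisensteinDVRSetting (κ.unitTwist (-1)) hm S hpS hbad L hL hLS jbar' cd Dd fs).π (W.eisensteinDVRSetting (κ.unitTwist (-1)) hm S hpS hbad L hL hLS jbar' cd Dd fs).e hy.killed hy.ker_red hπ he) j c) ∈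
            (W.baseChange K).selmerInfty κ →
      ∀ v ∉ S, galoisCohomology.localization ((W.eisensteinDVRSetting (κ.unitTwist (-1)) hm S hpS hbad L hL hLS jbar' cd Dd fs).T.ρ j) (Sum.inr v) 1 c ∈
        AdicTower.condA (W.eisensteinDVRSetting (κ.unitTwist (-1)) hm S hpS hbad L hL hLS jbar' cd Dd fs).T (W.eisensteinDVRSetting (κ.unitTwist (-1)) hm S hpS hbad L hL hLS jbar' cd Dd fs).π (W.eisensteinDVRSetting (κ.unitTwist (-1)) hm S hpS hbad L hL hLS jbar' cd Dd fs).e hy.killed hy.ker_red hπ he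
                (fun k => ((W.eisensteinDVRSetting (κ.unitTwist (-1)) hm S hpS hbad L hL hLS jbar' cd Dd fs).t k).cond) j (Sum.inr v) :=
    fun j hj c hc v hv ↦ hOff₂ j (hj₁ j hj) c hc v hv
  -- (hinf) the infinite places are complex
  have hinf' : ∀ j, j₁ + j₂ + j₃ ≤ j → ∀ c : galoisCohomology ((W.eisensteinDVRSetting (κ.unitTwist (-1)) hm S hpS hbad L hL hLS jbar' cd Dd fs).T.ρ j) 1,
      W.eisensteinTowerReadout κ hm (W.eisensteinDVRSetting (κ.unitTwist (-1)) hm S hpS hbad L hL hLS jbar' cd Dd fs).π (W.eisensteinDVRSetting (κ.unitTwist (-1)) hm S hpS hbad L hL hLS jbar' cd Dd fs).e hy.killed hy.ker_red hπ he hπX hek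
              (AddCommGroup.DirectLimit.of (fun k => galoisCohomology ((W.eisensteinDVRSetting (κ.unitTwist (-1)) hm S hpS hbad L hL hLS jbar' cd Dd fs).T.ρ k) 1)
                (AdicTower.incH1LE (W.eisensteinDVRSetting (κ.unitTwist (-1)) hm S hpS hbad L hL hLS jbar' cd Dd fs).T (W.eisensteinDVRSetting (κ.unitTwist (-1)) hm S hpS hbad L hL hLS jbar' cd Dd fs).π (W.eisensteinDVRSetting (κ.unitTwist (-1)) hm S hpS hbad L hL hLS jbar' cd Dd fs).e hy.killed hy.ker_red hπ he) j c) ∈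
            (W.baseChange K).selmerInfty κ →
      ∀ w : InfinitePlace K, galoisCohomology.localization ((W.eisensteinDVRSetting (κ.unitTwist (-1)) hm S hpS hbad L hL hLS jbar' cd Dd fs).T.ρ j) (Sum.inl w) 1 c ∈
        AdicTower.condA (W.eisensteinDVRSetting (κ.unitTwist (-1)) hm S hpS hbad L hL hLS jbar' cd Dd fs).T (W.eisensteinDVRSetting (κ.unitTwist (-1)) hm S hpS hbad L hL hLS jbar' cd Dd fs).π (W.eisensteinDVRSetting (κ.unitTwist (-1)) hm S hpS hbad L hL hLS jbar' cd Dd fs).e hy.killed hy.ker_red hπ he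
                (fun k => ((W.eisensteinDVRSetting (κ.unitTwist (-1)) hm S hpS hbad L hL hLS jbar' cd Dd fs).t k).cond) j (Sum.inl w) := by
    intro j _ c _ w
    have h0 := galoisCohomology_one_toLocal_inl_eq_zero_of_isComplex ((W.eisensteinDVRSetting (κ.unitTwist (-1)) hm S hpS hbad L hL hLS jbar' cd Dd fs).T.ρ j)
      (IsTotallyComplex.isComplex w) (galoisCohomology.localization ((W.eisensteinDVRSetting (κ.unitTwist (-1)) hm S hpS hbad L hL hLS jbar' cd Dd fs).T.ρ j) (Sum.inl w) 1 c)
    rw [h0]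
    exact zero_mem _
  -- (hfin)
  have hfin' : ∀ j, j₁ + j₂ + j₃ ≤ j → ∀ v ∈ S, Finite (↥(F' j (Sum.inr v)) ⧸
      (AdicTower.condA (W.eisensteinDVRSetting (κ.unitTwist (-1)) hm S hpS hbad L hL hLS jbar' cd Dd fs).T (W.eisensteinDVRSetting (κ.unitTwist (-1)) hm S hpS hbad L hL hLS jbar' cd Dd fs).π (W.eisensteinDVRSetting (κ.unitTwist (-1)) hm S hpS hbad L hL hLS jbar' cd Dd fs).e hy.killed hy.ker_red hπ he
                (fun k => ((W.eisensteinDVRSetting (κ.unitTwist (-1)) hm S hpS hbad L hL hLS jbar' cd Dd fs).t k).cond) j (Sum.inr v)).addSubgroupOf (F' j (Sum.inr v))) :=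
    fun j hj v hv ↦ ((Classical.choose_spec (hex j v)) hj hv).2.1
  -- (hC) `∏_{v ∈ S} ≤ (p^(cP+cB))^#S ≤ p^((cP+cB) #S₀)`
  have hC' : ∀ j, j₁ + j₂ + j₃ ≤ j → ∏ v ∈ S, Nat.card (↥(F' j (Sum.inr v)) ⧸
      (AdicTower.condA (W.eisensteinDVRSetting (κ.unitTwist (-1)) hm S hpS hbad L hL hLS jbar' cd Dd fs).T (W.eisensteinDVRSetting (κ.unitTwist (-1)) hm S hpS hbad L hL hLS jbar' cd Dd fs).π (W.eisensteinDVRSetting (κ.unitTwist (-1)) hm S hpS hbad L hL hLS jbar' cd Dd fs).e hy.killed hy.ker_red hπ he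
                (fun k => ((W.eisensteinDVRSetting (κ.unitTwist (-1)) hm S hpS hbad L hL hLS jbar' cd Dd fs).t k).cond) j (Sum.inr v)).addSubgroupOf (F' j (Sum.inr v))) ≤ p ^ ((cP + cB) * hS₀.toFinset.card) := by
    intro j hj
    refine (Finset.prod_le_pow_card S _ (p ^ (cP + cB))
      (fun v hv ↦ ((Classical.choose_spec (hex j v)) hj hv).2.2)).trans ?_
    rw [← pow_mul]
    exact Nat.pow_le_pow_right hppos (Nat.mul_le_mul_left _ hScard)
  exact W.finite_and_natCard_kerPsi_quotient_eisensteinTowerReadout_le_of_local κ hm hyp.topGenerator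
    hyp.noPTorsion S hpS hbad L hL hLS jbar' cd Dd fs hy hπ he hπX hek S F' (j₁ + j₂ + j₃)
    (p ^ ((cP + cB) * hS₀.toFinset.card)) hS' hoff' hinf' hfin' hC'

end Summit.BirchSwinnertonDyer.BirchSwinnertonDyer.Theorems.HeegnerMuPartControlGlue

end
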